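import Mathlib.Analysis.InnerProductSpace.PiL2
import Mathlib.Analysis.InnerProductSpace.Calculus
import Mathlib.Algebra.Polynomial.BigOperators
import Mathlib.Algebra.Polynomial.Degree.Support
import Mathlib.Algebra.Polynomial.Eval.Defs
import HarnessLib

/-!
# The cubic Veronese map makes any four distinct points affinely independent

Topic `Literature/Topology/Immersions`; elementary algebra feeding the general-position
arguments for maps into Euclidean space (`DoublePointsGenericity.lean` and its sequels): the
multiple-point transversality families `f + (T s) ∘ ρ` are submersive in the parameter as soon
as the auxiliary map `ρ` sends the (≤ 4) distinct points in question to **affinely independent**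
points. An injective `ρ` only guarantees this for pairs; composing it with the **cubic Veronese
map** `u ↦ (u_a, u_a u_b, u_a u_b u_c)_{a,b,c}` (all monomials of degree `1, 2, 3`) upgrades it to
quadruples — the classical fact that `m ≤ d + 1` distinct points have linearly independent images
under the degree-`d` Veronese embedding (evaluation of polynomials of degree `≤ d` separates
them: Lagrange interpolation along a generic linear coordinate; cf. Harris, *Algebraic Geometry:
A First Course* (1992), Example 1.14 / Lecture 18 on the rational normal curve: "any `d + 1`
points of a rational normal curve of degree `d` are linearly independent").

* `veronese k : ℝᵏ → ℝ^{VIdx k}` — the cubic Veronese map; `contDiff_veronese`,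
  `injective_veronese`;
* `exists_forall_bil_ne_zero` — finitely many nonzero vectors have a common non-orthogonal
  direction (a generic linear coordinate);
* `linearIndependent_one_veronese` — **for `m ≤ 4` distinct points `pᵢ ∈ ℝᵏ` the vectors
  `(1, veronese pᵢ) ∈ ℝ × ℝ^{VIdx k}` are linearly independent**;
* `linearIndependent_veronese_sub` — hence consecutive differences
  `veronese pᵢ - veronese pᵢ₊₁` are linearly independent (the form used by the transversality
  families).

Everything here is proved; no named facts are introduced.

## References

* J. Harris, *Algebraic Geometry: A First Course*, GTM 133 (1992), Lecture 1 Example 1.14 and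
  Lecture 18 (rational normal curves, Veronese maps: independence of points).
* M. Golubitsky, V. Guillemin, *Stable Mappings and Their Singularities* (1973), Ch. II §4
  (polynomial perturbation families in multijet transversality).
-/

open scoped ContDiff
open Function Finset Polynomial

noncomputable section

namespace Literature.Topology.Immersions

/-- Local notation: `𝔼 n` is the model Euclidean space `EuclideanSpace ℝ (Fin n)`. -/
local notation "𝔼 " n:arg => EuclideanSpace ℝ (Fin n)

variable {k : ℕ}

/-- The index type of the monomials of degree `1, 2, 3` in `k` variables (ordered, with
repetitions). [folklore] -/
abbrev VIdx (k : ℕ) : Type := Fin k ⊕ (Fin k × Fin k) ⊕ (Fin k × Fin k × Fin k)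

/-- The coordinates of the cubic Veronese map. [folklore] -/
def veroneseFun (u : 𝔼 k) : VIdx k → ℝ
  | Sum.inl a => u a
  | Sum.inr (Sum.inl ab) => u ab.1 * u ab.2
  | Sum.inr (Sum.inr abc) => u abc.1 * u abc.2.1 * u abc.2.2

/-- **The cubic Veronese map** `u ↦ (u_a, u_a u_b, u_a u_b u_c)_{a,b,c} : ℝᵏ → ℝ^{VIdx k}`.
[folklore] -/
def veronese (k : ℕ) (u : 𝔼 k) : EuclideanSpace ℝ (VIdx k) := WithLp.toLp 2 (veroneseFun u)

/-- Degree-one coordinates of the Veronese map. [folklore] -/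
@[simp] theorem veronese_inl (u : 𝔼 k) (a : Fin k) : veronese k u (Sum.inl a) = u a := rfl

/-- Degree-two coordinates of the Veronese map. [folklore] -/
@[simp] theorem veronese_inr_inl (u : 𝔼 k) (ab : Fin k × Fin k) :
    veronese k u (Sum.inr (Sum.inl ab)) = u ab.1 * u ab.2 := rfl

/-- Degree-three coordinates of the Veronese map. [folklore] -/
@[simp] theorem veronese_inr_inr (u : 𝔼 k) (abc : Fin k × Fin k × Fin k) :
    veronese k u (Sum.inr (Sum.inr abc)) = u abc.1 * u abc.2.1 * u abc.2.2 := rfl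

/-- The Veronese map is `C^∞` (polynomial coordinates). [folklore] -/
theorem contDiff_veronese : ContDiff ℝ ∞ (veronese k) := by
  rw [contDiff_euclidean]
  have hc : ∀ a : Fin k, ContDiff ℝ ∞ (fun u : 𝔼 k => u a) := fun a =>
    (EuclideanSpace.proj (𝕜 := ℝ) a).contDiff
  rintro (a | ab | abc)
  · exact hc a
  · exact (hc ab.1).mul (hc ab.2)
  · exact ((hc abc.1).mul (hc abc.2.1)).mul (hc abc.2.2)

/-- The Veronese map is injective (its degree-one part is the identity). [folklore] -/
theorem injective_veronese : Injective (veronese k) := by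
  intro u v h
  ext a
  have := congrArg (fun w => w (Sum.inl a)) h
  simpa using this

/-! ### A generic linear coordinate -/

/-- The coordinate pairing `B d w = Σ_a d_a w_a`. [folklore] -/
def bil (d w : 𝔼 k) : ℝ := ∑ a, d a * w a

/-- `B` is additive in the first slot. [folklore] -/
theorem bil_add_left (d d' w : 𝔼 k) : bil (d + d') w = bil d w + bil d' w := by
  simp only [bil, PiLp.add_apply, add_mul, sum_add_distrib]

/-- `B` is homogeneous in the first slot. [folklore] -/
theorem bil_smul_left (t : ℝ) (d w : 𝔼 k) : bil (t • d) w = t * bil d w := by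
  simp only [bil, PiLp.smul_apply, smul_eq_mul, mul_assoc, mul_sum]

/-- `B` is subtractive in the second slot. [folklore] -/
theorem bil_sub_right (d w w' : 𝔼 k) : bil d (w - w') = bil d w - bil d w' := by
  simp only [bil, PiLp.sub_apply, mul_sub, sum_sub_distrib]

/-- `B w w > 0` for `w ≠ 0`. [folklore] -/
theorem bil_self_pos {w : 𝔼 k} (hw : w ≠ 0) : 0 < bil w w := by
  obtain ⟨a, ha⟩ : ∃ a, w a ≠ 0 := by
    by_contra h
    push Not at h
    exact hw (PiLp.ext h)
  have hle : ∀ b ∈ (univ : Finset (Fin k)), 0 ≤ w b * w b := fun b _ => mul_self_nonneg _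
  exact lt_of_lt_of_le (mul_self_pos.2 ha) (single_le_sum hle (mem_univ a))

/-- **Finitely many nonzero vectors have a common non-orthogonal direction**: for a finite set
`s` of nonzero vectors of `ℝᵏ` there is `d` with `Σ_a d_a w_a ≠ 0` for all `w ∈ s` (perturb a
direction good for `s` along the new vector, avoiding finitely many parameters). [folklore] -/
theorem exists_forall_bil_ne_zero (s : Finset (𝔼 k)) (hs : ∀ w ∈ s, w ≠ 0) :
    ∃ d : 𝔼 k, ∀ w ∈ s, bil d w ≠ 0 := by
  classical
  induction s using Finset.induction_on with
  | empty => exact ⟨0, by simp⟩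
  | insert w s hw ih =>
    obtain ⟨d, hd⟩ := ih fun w' hw' => hs w' (mem_insert_of_mem hw')
    have hw0 : w ≠ 0 := hs w (mem_insert_self w s)
    have hww : bil w w ≠ 0 := (bil_self_pos hw0).ne'
    -- the finitely many bad parameters
    let bad : Finset ℝ := insert (-(bil d w) / bil w w)
      (s.image fun w' => -(bil d w') / bil w w')
    obtain ⟨t, ht⟩ : ∃ t : ℝ, t ∉ bad := Infinite.exists_notMem_finset bad
    refine ⟨d + t • w, fun w' hw' => ?_⟩
    rw [bil_add_left, bil_smul_left]
    rcases Finset.mem_insert.1 hw' with rfl | hw's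
    · -- the new vector
      intro h0
      apply ht
      rw [Finset.mem_insert]
      left
      field_simp
      linarith
    · intro h0
      by_cases hc : bil w w' = 0
      · rw [hc, mul_zero, add_zero] at h0
        exact hd w' hw's h0
      · apply ht
        rw [Finset.mem_insert]
        right
        rw [Finset.mem_image]
        refine ⟨w', hw's, ?_⟩
        field_simp
        linarith

/-- For finitely many distinct points there is a linear coordinate separating them. [folklore] -/
theorem exists_bil_injective {m : ℕ} {p : Fin m → 𝔼 k} (hp : Injective p) :
    ∃ d : 𝔼 k, Injective fun i => bil d (p i) := by
  classical
  let s : Finset (𝔼 k) := (univ : Finset (Fin m × Fin m)).filter (fun ij => ij.1 ≠ ij.2)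
    |>.image fun ij => p ij.1 - p ij.2
  have hs : ∀ w ∈ s, w ≠ 0 := by
    intro w hw
    obtain ⟨ij, hij, rfl⟩ := mem_image.1 hw
    have hne : ij.1 ≠ ij.2 := (mem_filter.1 hij).2
    exact sub_ne_zero.2 fun h => hne (hp h)
  obtain ⟨d, hd⟩ := exists_forall_bil_ne_zero s hs
  refine ⟨d, fun i j hij => ?_⟩
  by_contra hne
  have hmem : p i - p j ∈ s := mem_image.2 ⟨(i, j), mem_filter.2 ⟨mem_univ _, hne⟩, rfl⟩
  have := hd _ hmem
  rw [bil_sub_right] at this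
  exact this (sub_eq_zero.2 hij)

/-! ### Polynomials of degree `≤ 3` in a linear coordinate are linear in the Veronese coordinates -/

/-- The three coordinate sums of the functional `vfun`. [folklore] -/
def vsum₁ (d : 𝔼 k) (v : EuclideanSpace ℝ (VIdx k)) : ℝ := ∑ a : Fin k, d a * v (Sum.inl a)

/-- See `vsum₁`. [folklore] -/
def vsum₂ (d : 𝔼 k) (v : EuclideanSpace ℝ (VIdx k)) : ℝ :=
  ∑ ab : Fin k × Fin k, d ab.1 * d ab.2 * v (Sum.inr (Sum.inl ab))

/-- See `vsum₁`. [folklore] -/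
def vsum₃ (d : 𝔼 k) (v : EuclideanSpace ℝ (VIdx k)) : ℝ :=
  ∑ abc : Fin k × Fin k × Fin k, d abc.1 * d abc.2.1 * d abc.2.2 * v (Sum.inr (Sum.inr abc))

/-- `vsum₁` is additive. [folklore] -/
theorem vsum₁_add (d : 𝔼 k) (v w : EuclideanSpace ℝ (VIdx k)) :
    vsum₁ d (v + w) = vsum₁ d v + vsum₁ d w := by
  simp only [vsum₁, PiLp.add_apply, mul_add, sum_add_distrib]

/-- `vsum₂` is additive. [folklore] -/
theorem vsum₂_add (d : 𝔼 k) (v w : EuclideanSpace ℝ (VIdx k)) :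
    vsum₂ d (v + w) = vsum₂ d v + vsum₂ d w := by
  simp only [vsum₂, PiLp.add_apply, mul_add, sum_add_distrib]

/-- `vsum₃` is additive. [folklore] -/
theorem vsum₃_add (d : 𝔼 k) (v w : EuclideanSpace ℝ (VIdx k)) :
    vsum₃ d (v + w) = vsum₃ d v + vsum₃ d w := by
  simp only [vsum₃, PiLp.add_apply, mul_add, sum_add_distrib]

/-- `vsum₁` is homogeneous. [folklore] -/
theorem vsum₁_smul (d : 𝔼 k) (t : ℝ) (v : EuclideanSpace ℝ (VIdx k)) :
    vsum₁ d (t • v) = t * vsum₁ d v := by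
  simp only [vsum₁, PiLp.smul_apply, smul_eq_mul, mul_sum]
  exact sum_congr rfl fun a _ => by ring

/-- `vsum₂` is homogeneous. [folklore] -/
theorem vsum₂_smul (d : 𝔼 k) (t : ℝ) (v : EuclideanSpace ℝ (VIdx k)) :
    vsum₂ d (t • v) = t * vsum₂ d v := by
  simp only [vsum₂, PiLp.smul_apply, smul_eq_mul, mul_sum]
  exact sum_congr rfl fun a _ => by ring

/-- `vsum₃` is homogeneous. [folklore] -/
theorem vsum₃_smul (d : 𝔼 k) (t : ℝ) (v : EuclideanSpace ℝ (VIdx k)) :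
    vsum₃ d (t • v) = t * vsum₃ d v := by
  simp only [vsum₃, PiLp.smul_apply, smul_eq_mul, mul_sum]
  exact sum_congr rfl fun a _ => by ring

/-- The linear functional `v ↦ c₁ Σ dₐ v_a + c₂ Σ dₐ d_b v_{ab} + c₃ Σ dₐ d_b d_c v_{abc}` on the
Veronese coordinates. [folklore] -/
def vfun (d : 𝔼 k) (c₁ c₂ c₃ : ℝ) : EuclideanSpace ℝ (VIdx k) →ₗ[ℝ] ℝ where
  toFun v := c₁ * vsum₁ d v + c₂ * vsum₂ d v + c₃ * vsum₃ d v
  map_add' v w := by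
    rw [vsum₁_add, vsum₂_add, vsum₃_add]
    ring
  map_smul' t v := by
    rw [vsum₁_smul, vsum₂_smul, vsum₃_smul, RingHom.id_apply, smul_eq_mul]
    ring

/-- Unfolding of `vfun`. [folklore] -/
theorem vfun_apply (d : 𝔼 k) (c₁ c₂ c₃ : ℝ) (v : EuclideanSpace ℝ (VIdx k)) :
    vfun d c₁ c₂ c₃ v = c₁ * vsum₁ d v + c₂ * vsum₂ d v + c₃ * vsum₃ d v := rfl

/-- `vsum₁ d (veronese u) = t`, `t = Σ dₐ uₐ`. [folklore] -/
theorem vsum₁_veronese (d u : 𝔼 k) : vsum₁ d (veronese k u) = bil d u := rfl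

/-- `vsum₂ d (veronese u) = t²`. [folklore] -/
theorem vsum₂_veronese (d u : 𝔼 k) : vsum₂ d (veronese k u) = bil d u ^ 2 := by
  rw [pow_two, bil, sum_mul_sum, vsum₂]
  simp only [Fintype.sum_prod_type]
  refine sum_congr rfl fun a _ => sum_congr rfl fun b _ => ?_
  rw [veronese_inr_inl]
  ring

/-- `vsum₃ d (veronese u) = t³`. [folklore] -/
theorem vsum₃_veronese (d u : 𝔼 k) : vsum₃ d (veronese k u) = bil d u ^ 3 := by
  have h2 : bil d u * bil d u = ∑ b, ∑ c, (d b * u b) * (d c * u c) := sum_mul_sum _ _ _ _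
  rw [pow_succ', pow_two, h2, bil, sum_mul_sum]
  simp only [mul_sum]
  rw [vsum₃]
  simp only [Fintype.sum_prod_type]
  refine sum_congr rfl fun a _ => sum_congr rfl fun b _ => sum_congr rfl fun c _ => ?_
  rw [veronese_inr_inr]
  ring

/-- **`vfun d c (veronese u) = c₁ t + c₂ t² + c₃ t³`, `t = Σ dₐ uₐ`.** [folklore] -/
theorem vfun_veronese (d : 𝔼 k) (c₁ c₂ c₃ : ℝ) (u : 𝔼 k) :
    vfun d c₁ c₂ c₃ (veronese k u) = c₁ * bil d u + c₂ * bil d u ^ 2 + c₃ * bil d u ^ 3 := by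
  rw [vfun_apply, vsum₁_veronese, vsum₂_veronese, vsum₃_veronese]

/-! ### Independence of at most four Veronese points -/

/-- **Any `m ≤ 4` distinct points of `ℝᵏ` have linearly independent vectors
`(1, veronese pᵢ)`** (i.e. affinely independent Veronese images): for a linear coordinate
`t = Σ dₐ uₐ` separating the points, the Lagrange polynomial of degree `≤ 3` vanishing at all
nodes but `tᵢ` is a linear functional of `(1, veronese u)`. [folklore] -/
theorem linearIndependent_one_veronese {m : ℕ} (hm : m ≤ 4) {p : Fin m → 𝔼 k}
    (hp : Injective p) :
    LinearIndependent ℝ fun i => ((1 : ℝ), veronese k (p i)) := by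
  classical
  obtain ⟨d, hd⟩ := exists_bil_injective hp
  rw [Fintype.linearIndependent_iff]
  intro g hg i
  -- Lagrange polynomial vanishing at the other nodes
  let P : ℝ[X] := ∏ j ∈ univ.erase i, (X - C (bil d (p j)))
  have hdeg : P.natDegree < 4 := by
    calc P.natDegree ≤ ∑ j ∈ univ.erase i, (X - C (bil d (p j))).natDegree :=
          natDegree_prod_le _ _
      _ = (univ.erase i).card := by simp
      _ < 4 := by
          rw [card_erase_of_mem (mem_univ i), card_univ, Fintype.card_fin]
          omega
  have hP : P = ∑ r ∈ range 4, monomial r (P.coeff r) := as_sum_range' P 4 hdeg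
  have heval : ∀ t : ℝ, P.eval t =
      P.coeff 0 + (P.coeff 1 * t + P.coeff 2 * t ^ 2 + P.coeff 3 * t ^ 3) := by
    intro t
    conv_lhs => rw [hP]
    simp only [sum_range_succ, sum_range_zero, zero_add, eval_add, eval_monomial]
    ring
  have heval_node : ∀ l, l ≠ i → P.eval (bil d (p l)) = 0 := by
    intro l hl
    rw [eval_prod]
    exact prod_eq_zero (mem_erase.2 ⟨hl, Finset.mem_univ l⟩) (by simp)
  have hnode_ne : P.eval (bil d (p i)) ≠ 0 := by
    rw [eval_prod, prod_ne_zero_iff]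
    intro j hj
    have hji : j ≠ i := (mem_erase.1 hj).1
    simp only [eval_sub, eval_X, eval_C]
    exact sub_ne_zero.2 fun h => hji (hd h).symm
  -- the linear functional `φ (c, v) = coeff₀ c + vfun (coeff₁, coeff₂, coeff₃) v`
  let φ : (ℝ × EuclideanSpace ℝ (VIdx k)) →ₗ[ℝ] ℝ :=
    P.coeff 0 • LinearMap.fst ℝ ℝ (EuclideanSpace ℝ (VIdx k)) +
      (vfun d (P.coeff 1) (P.coeff 2) (P.coeff 3)).comp
        (LinearMap.snd ℝ ℝ (EuclideanSpace ℝ (VIdx k)))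
  have hφ : ∀ u : 𝔼 k, φ ((1 : ℝ), veronese k u) = P.eval (bil d u) := by
    intro u
    simp only [φ, LinearMap.add_apply, LinearMap.smul_apply, LinearMap.fst_apply,
      LinearMap.comp_apply, LinearMap.snd_apply, smul_eq_mul, mul_one, vfun_veronese, heval]
  have h := congrArg φ hg
  rw [map_sum, map_zero] at h
  simp only [map_smul, hφ, smul_eq_mul] at h
  rw [Finset.sum_eq_single i (fun l _ hl => by rw [heval_node l hl, mul_zero])
    (fun hi => absurd (Finset.mem_univ i) hi)] at h
  exact (mul_eq_zero.1 h).resolve_right hnode_ne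

/-- From affine independence of three points to independence of the two differences.
[folklore] -/
theorem linearIndependent_pair_sub_of_one {V : Type*} [AddCommGroup V] [Module ℝ V]
    {a b c : V} (h : LinearIndependent ℝ ![((1 : ℝ), a), ((1 : ℝ), b), ((1 : ℝ), c)]) :
    LinearIndependent ℝ ![a - b, b - c] := by
  rw [Fintype.linearIndependent_iff] at h ⊢
  intro g hg
  have hrel : ∑ i, (![g 0, g 1 - g 0, -g 1] : Fin 3 → ℝ) i • (![((1 : ℝ), a), ((1 : ℝ), b),
      ((1 : ℝ), c)] : Fin 3 → ℝ × V) i = 0 := by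
    rw [Fin.sum_univ_two] at hg
    simp only [Matrix.cons_val_zero, Matrix.cons_val_one] at hg
    rw [Fin.sum_univ_three]
    simp only [Matrix.cons_val_zero, Matrix.cons_val_one, Matrix.cons_val_two, Matrix.head_cons,
      Matrix.tail_cons, Prod.smul_mk, Prod.mk_add_mk, smul_eq_mul, mul_one, Prod.mk_eq_zero]
    refine ⟨by ring, ?_⟩
    rw [← hg]
    simp only [smul_sub, sub_smul, neg_smul]
    abel
  have h0 := h _ hrel
  intro i
  fin_cases i
  · simpa using h0 0
  · have := h0 2
    simp at this
    simpa using this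

/-- From affine independence of four points to independence of the three differences.
[folklore] -/
theorem linearIndependent_triple_sub_of_one {V : Type*} [AddCommGroup V] [Module ℝ V]
    {a b c e : V}
    (h : LinearIndependent ℝ ![((1 : ℝ), a), ((1 : ℝ), b), ((1 : ℝ), c), ((1 : ℝ), e)]) :
    LinearIndependent ℝ ![a - b, b - c, c - e] := by
  rw [Fintype.linearIndependent_iff] at h ⊢
  intro g hg
  have hrel : ∑ i, (![g 0, g 1 - g 0, g 2 - g 1, -g 2] : Fin 4 → ℝ) i •
      (![((1 : ℝ), a), ((1 : ℝ), b), ((1 : ℝ), c), ((1 : ℝ), e)] : Fin 4 → ℝ × V) i = 0 := by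
    rw [Fin.sum_univ_three] at hg
    simp only [Matrix.cons_val_zero, Matrix.cons_val_one, Matrix.cons_val_two, Matrix.head_cons,
      Matrix.tail_cons] at hg
    rw [Fin.sum_univ_four]
    simp only [Matrix.cons_val_zero, Matrix.cons_val_one, Matrix.cons_val_two,
      Matrix.cons_val_three, Matrix.head_cons, Matrix.tail_cons, Prod.smul_mk, Prod.mk_add_mk,
      smul_eq_mul, mul_one, Prod.mk_eq_zero]
    refine ⟨by ring, ?_⟩
    rw [← hg]
    simp only [smul_sub, sub_smul, neg_smul]
    abel
  have h0 := h _ hrel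
  have e0 : g 0 = 0 := by simpa using h0 0
  have e1 : g 1 = 0 := by
    have := h0 1
    simp at this
    linarith
  have e2 : g 2 = 0 := by
    have := h0 3
    simpa using this
  intro i
  fin_cases i
  · exact e0
  · exact e1
  · exact e2

/-- **Three distinct points have independent Veronese differences.** [folklore] -/
theorem linearIndependent_veronese_pair_sub {a b c : 𝔼 k} (hab : a ≠ b) (hbc : b ≠ c)
    (hac : a ≠ c) :
    LinearIndependent ℝ ![veronese k a - veronese k b, veronese k b - veronese k c] := by
  have hinj : Injective (![a, b, c] : Fin 3 → 𝔼 k) := by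
    intro i j hij
    fin_cases i <;> fin_cases j <;> simp_all [eq_comm]
  have h := linearIndependent_one_veronese (m := 3) (by norm_num) hinj
  refine linearIndependent_pair_sub_of_one ?_
  convert h using 1
  funext i
  fin_cases i <;> rfl

/-- **Four distinct points have independent Veronese differences.** [folklore] -/
theorem linearIndependent_veronese_triple_sub {a b c e : 𝔼 k} (hab : a ≠ b) (hac : a ≠ c)
    (hae : a ≠ e) (hbc : b ≠ c) (hbe : b ≠ e) (hce : c ≠ e) :
    LinearIndependent ℝ
      ![veronese k a - veronese k b, veronese k b - veronese k c, veronese k c - veronese k e] := by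
  have hinj : Injective (![a, b, c, e] : Fin 4 → 𝔼 k) := by
    intro i j hij
    fin_cases i <;> fin_cases j <;> simp_all [eq_comm]
  have h := linearIndependent_one_veronese (m := 4) le_rfl hinj
  refine linearIndependent_triple_sub_of_one ?_
  convert h using 1
  funext i
  fin_cases i <;> rfl

end Literature.Topology.Immersions
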